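import Mathlib
import HarnessLib
import Summits.HubbardSuperconductivity.HubbardSuperconductivity.Theorems.KLProgrammeKLRegimeSectorSliceFamilyDefectRows
import Summits.HubbardSuperconductivity.HubbardSuperconductivity.Theorems.KLProgrammeKLRegimeSliceSymbolLine
import Summits.HubbardSuperconductivity.HubbardSuperconductivity.Theorems.KLProgrammeKLRegimeFatMultiplierIncrementPairData
import Summits.HubbardSuperconductivity.HubbardSuperconductivity.Theorems.KLProgrammeKLRegimeSectorSliceGramFat
import Summits.HubbardSuperconductivity.HubbardSuperconductivity.Theorems.KLProgrammeKLRegimeTwoVolumeSliceFrameDefect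

/-!
# Route `KLProgramme` — VL child `KLRegimeVolumeLimitV17F2` (stmt-HubbardSuperconductivity-20440), closer MODEL file M2 «MISMATCH-SLICE», brackets (a)(b),
# FAMILY-DEFECT HALF, generic layer: PLAIN rows / columns / entry of `S(F′)ᵀ·C^K_{(Λ,Λ′]}·S(F′) − S(F)ᵀ·C^K_{(Λ,Λ′]}·S(F)` from per-pair data

Cell `gate-hubbard-kl`, seat hubbard-kl-k3c4-p2 (g13; UV / Matsubara all-U lane); WANT (w7) of the VL registrant k3c4-p1 g12 (KL STATUS 2026-08-28 00:32Z), second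
half: his `E_j = S(F̃[K″])ᵀC[K″]S(F̃[K″]) − S(F̃[K])ᵀC[K]S(F̃[K])` splits as the symbol defect at the family `F̃[K″]` (rate form: `…SectorSliceDefectRate`, p593823)
plus the FAMILY defect at the covariance `C[K]` treated here.  k3c3-p2's `…SectorSliceFamilyDefectRows` (p583924) reduces the WEIGHTED rows of the family defect
to weighted per-pair Fourier sums of `G^Δ_{ωω′} = (βL²)⁻²(F′_ωF′_{ω′} − F_ωF_{ω′})·Ψ̂`; the plain currency of the response bracket (`sE/cR/cC` of
`sum_norm_kernel_effAction_add_sub_le_response_of_gramBounded`) is the weight `w ≡ 1`: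

* §1 `rowSum_sliceCT_familySub_le_of_pairBound` / `colSum_sliceCT_familySub_le_of_pairBound` — plain rows / columns `≤ 8·Σ_{ω′} T(ω, ω′)` from per-pair PLAIN
  `ℓ¹` bounds `Σ_z ‖Σ_q χχ • G^Δ_{ωω′}(q)‖ ≤ T(ω, ω′)` (the per-pair datum is k3c3-p2's fat increment pair `(F̃^{K_o}_ω − F̃^K_ω)·F̃^K_{ω′}` twice, (D5a));
* §2 `card_filter_prodTorus_le_card_filter` (the product-torus labels inject into `FreqMomentum`), `norm_charSum_le_card_mul_sup` (a character sum is at most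
  support count × sup), **`norm_pullback_normalCovariance_familySub_le_of_count`** — the ENTRY of the family defect is `≤ 2·‖(βL²)⁻¹‖²·((Ns + Ns′)·(δ₂·P))` from:
  `‖F‖, ‖F′‖ ≤ 1`-free data — the sup `δ₂` of the pair difference `F′_ωF′_{ω′} − F_ωF_{ω′}`, the sup `P` of the symbol, and the support counts `Ns, Ns′` of `F_ω, F′_ω`
  (uniform in `ω`); every term carries `δ₂ = O(ε)`, no row, hence no grid density `M/β`;
* §3 `norm_sliceCT_familySub_bgmFat_apply_le` (model: fat families of two admissible frames against the coarse slice; counts = p3's `card_support_bgmFat_le`,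
  `δ₂` = twice k3c3-p2's `bgmFatIncrPair_data` sup, `P = 4βL²/Λ`), **`exists_familyDefect_entry_rate`** (`∃ C ≥ 0` free of `(L, M, K, K_o, ε)`:
  `‖D Y Y′‖ ≤ C·ε` for `ε ∈ [0,1]` above `coeffNorm j (K_o ⊖ K)`, `j ≤ 3`).
Proofs only; no definitions. [cite: BenfattoGiulianiMastropietro2006, §2.7 (2.66)–(2.67); §3 (3.3)]
-/

noncomputable section

namespace Summit.HubbardSuperconductivity.HubbardSuperconductivity.Theorems.TorusFourierL2

set_option linter.dupNamespace false -- summit = problem name (single-conjunct summit), D-0017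

open Finset Literature.MathematicalPhysics.QuantumLattice Literature.Probability.LatticeModels
open Summit.HubbardSuperconductivity.HubbardSuperconductivity.Theorems.KLRegimeSplit
open Summit.HubbardSuperconductivity.HubbardSuperconductivity.Theorems.KLProgrammeLegKernels
open Summit.HubbardSuperconductivity.HubbardSuperconductivity.Theorems.PerturbedFermiCurve
open Summit.HubbardSuperconductivity.HubbardSuperconductivity.Theorems.DispersionFlow
open Literature.MathematicalPhysics.QuantumLattice.BandSectorCounting Literature.MathematicalPhysics.QuantumLattice.FermiRG Literature.Analysis.SpecialFunctions
open scoped Real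

/-! ## §1 Plain rows and columns from per-pair plain `ℓ¹` bounds -/

section Rows

variable {L M N : ℕ} [NeZero L] [NeZero M]

/-- **Plain ROW sums of the family defect from per-pair plain `ℓ¹` bounds** (`w ≡ 1` in `rowSumWt_norm_pullback_normalCovariance_familySub_le`):
`Σ_{Y′} ‖D Y Y′‖ ≤ 8·Σ_{ω′} T(ω_Y, ω′)`. [cite: BenfattoGiulianiMastropietro2006, §2.7 (2.66)–(2.67); §3 (3.3)] -/
theorem rowSum_sliceCT_familySub_le_of_pairBound {β : ℝ} (hβ : 0 < β) (μ : ℝ) (K : TrigPolyC4v) (Λ Λ' : ℝ)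
    (F' F : Fin N → FreqMomentum L M → ℂ) {T : Fin N → Fin N → ℝ}
    (hT : ∀ ω ω' : Fin N, ∑ z : TorusSite 1 (2 * M) × TorusSite 2 L,
        ‖∑ q : TorusSite 1 (2 * M) × TorusSite 2 L, (torusChar q.1 z.1 * torusChar q.2 z.2) •
          ((((1 / (β * (L : ℝ) ^ 2) : ℝ) : ℂ) ^ 2 *
            ((F' ω (⟨(q.1 0).val, ZMod.val_lt (q.1 0)⟩, q.2) * F' ω' (⟨(q.1 0).val, ZMod.val_lt (q.1 0)⟩, q.2) -
              F ω (⟨(q.1 0).val, ZMod.val_lt (q.1 0)⟩, q.2) * F ω' (⟨(q.1 0).val, ZMod.val_lt (q.1 0)⟩, q.2)) *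
              sliceSymbolFnXi (β * (L : ℝ) ^ 2) 0 Λ Λ' (matsubaraFreq β M ⟨(q.1 0).val, ZMod.val_lt (q.1 0)⟩) (nambuXiCT L μ K q.2))))‖ ≤ T ω ω')
    (Y : SpaceTimeIdx L M × SectorLeg N) :
    ∑ Y' : SpaceTimeIdx L M × SectorLeg N,
        ‖((sectorSubMatrix L M β F').transpose * hubbardCovSliceCT L M β μ 0 K Λ Λ' * sectorSubMatrix L M β F' -
            (sectorSubMatrix L M β F).transpose * hubbardCovSliceCT L M β μ 0 K Λ Λ' * sectorSubMatrix L M β F) Y Y'‖ ≤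
      8 * ∑ ω' : Fin N, T Y.2.1.1 ω' := by
  rw [hubbardCovSliceCT_eq_normalCovariance_sliceSymbolFnXi hβ.ne' μ K Λ Λ']
  have h := rowSumWt_norm_pullback_normalCovariance_familySub_le hβ.ne'
    (fun ω k => sliceSymbolFnXi (β * (L : ℝ) ^ 2) 0 Λ Λ' ω (nambuXiCT L μ K k)) F' F (fun _ => (1 : ℝ)) (fun _ => zero_le_one)
    (fun _ _ => rfl) Y
  simp only [mul_one, one_mul] at h
  exact h.trans (mul_le_mul_of_nonneg_left (sum_le_sum fun ω' _ => hT _ _) (by norm_num))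

/-- **Plain COLUMN sums of the family defect from per-pair plain `ℓ¹` bounds**: `Σ_Y ‖D Y Y′‖ ≤ 8·Σ_ω T(ω, ω_{Y′})`.
[cite: BenfattoGiulianiMastropietro2006, §2.7 (2.66)–(2.67); §3 (3.3)] -/
theorem colSum_sliceCT_familySub_le_of_pairBound {β : ℝ} (hβ : 0 < β) (μ : ℝ) (K : TrigPolyC4v) (Λ Λ' : ℝ)
    (F' F : Fin N → FreqMomentum L M → ℂ) {T : Fin N → Fin N → ℝ}
    (hT : ∀ ω ω' : Fin N, ∑ z : TorusSite 1 (2 * M) × TorusSite 2 L,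
        ‖∑ q : TorusSite 1 (2 * M) × TorusSite 2 L, (torusChar q.1 z.1 * torusChar q.2 z.2) •
          ((((1 / (β * (L : ℝ) ^ 2) : ℝ) : ℂ) ^ 2 *
            ((F' ω (⟨(q.1 0).val, ZMod.val_lt (q.1 0)⟩, q.2) * F' ω' (⟨(q.1 0).val, ZMod.val_lt (q.1 0)⟩, q.2) -
              F ω (⟨(q.1 0).val, ZMod.val_lt (q.1 0)⟩, q.2) * F ω' (⟨(q.1 0).val, ZMod.val_lt (q.1 0)⟩, q.2)) *
              sliceSymbolFnXi (β * (L : ℝ) ^ 2) 0 Λ Λ' (matsubaraFreq β M ⟨(q.1 0).val, ZMod.val_lt (q.1 0)⟩) (nambuXiCT L μ K q.2))))‖ ≤ T ω ω')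
    (Y' : SpaceTimeIdx L M × SectorLeg N) :
    ∑ Y : SpaceTimeIdx L M × SectorLeg N,
        ‖((sectorSubMatrix L M β F').transpose * hubbardCovSliceCT L M β μ 0 K Λ Λ' * sectorSubMatrix L M β F' -
            (sectorSubMatrix L M β F).transpose * hubbardCovSliceCT L M β μ 0 K Λ Λ' * sectorSubMatrix L M β F) Y Y'‖ ≤
      8 * ∑ ω : Fin N, T ω Y'.2.1.1 := by
  rw [hubbardCovSliceCT_eq_normalCovariance_sliceSymbolFnXi hβ.ne' μ K Λ Λ']
  have h := colSumWt_norm_pullback_normalCovariance_familySub_le hβ.ne'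
    (fun ω k => sliceSymbolFnXi (β * (L : ℝ) ^ 2) 0 Λ Λ' ω (nambuXiCT L μ K k)) F' F (fun _ => (1 : ℝ)) (fun _ => zero_le_one)
    (fun _ _ => rfl) Y'
  simp only [mul_one, one_mul] at h
  exact h.trans (mul_le_mul_of_nonneg_left (sum_le_sum fun ω _ => hT _ _) (by norm_num))

end Rows

/-! ## §2 The entry: support count × sup, no row -/

section Entry

variable {L M N : ℕ} [NeZero L] [NeZero M]

/-- The product-torus label `q ↦ (val q₁, q⃗)` is injective into `FreqMomentum`, so a filtered count over the labels is at most the filtered count over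
`FreqMomentum`. [folklore] -/
theorem card_filter_prodTorus_le_card_filter (Pk : FreqMomentum L M → Prop) [DecidablePred Pk] :
    ((univ : Finset (TorusSite 1 (2 * M) × TorusSite 2 L)).filter fun q => Pk (⟨(q.1 0).val, ZMod.val_lt (q.1 0)⟩, q.2)).card ≤
      ((univ : Finset (FreqMomentum L M)).filter Pk).card := by
  classical
  refine Finset.card_le_card_of_injOn (fun q => (⟨(q.1 0).val, ZMod.val_lt (q.1 0)⟩, q.2)) (fun q hq => ?_) (fun q₁ hq₁ q₂ hq₂ h => ?_)
  · rw [mem_coe, mem_filter] at hq ⊢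
    exact ⟨mem_univ _, hq.2⟩
  · have h' : ((⟨(q₁.1 0).val, ZMod.val_lt (q₁.1 0)⟩ : MatsubaraIdx M), q₁.2) = (⟨(q₂.1 0).val, ZMod.val_lt (q₂.1 0)⟩, q₂.2) := h
    obtain ⟨h1, h2⟩ := Prod.ext_iff.1 h'
    have h1' : (q₁.1 0).val = (q₂.1 0).val := congrArg Fin.val h1
    refine Prod.ext (funext fun i => ?_) h2
    have hi : i = 0 := Subsingleton.elim _ _
    subst hi
    exact ZMod.val_injective _ h1'

/-- **A character sum is at most support count × sup**: `‖Σ_q χ(q) • G(q)‖ ≤ #{G ≠ 0}·S` if `‖G‖ ≤ S` and `‖χ‖ ≤ 1`. [folklore] -/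
theorem norm_charSum_le_card_mul_sup (χ : TorusSite 1 (2 * M) × TorusSite 2 L → ℂ) (hχ : ∀ q, ‖χ q‖ ≤ 1)
    (G : TorusSite 1 (2 * M) × TorusSite 2 L → ℂ) {S : ℝ} (hS : ∀ q, ‖G q‖ ≤ S) [DecidablePred fun q => G q ≠ 0] :
    ‖∑ q, χ q • G q‖ ≤ (((univ : Finset _).filter fun q => G q ≠ 0).card : ℝ) * S := by
  classical
  refine (norm_sum_le _ _).trans ?_
  refine (sum_le_card_mul_of_support _ (S := S) (fun q => ?_) ((univ : Finset _).filter fun q => G q ≠ 0) (fun q hq => ?_)).trans le_rfl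
  · rw [norm_smul]
    calc ‖χ q‖ * ‖G q‖ ≤ 1 * S := mul_le_mul (hχ q) (hS q) (norm_nonneg _) zero_le_one
      _ = S := one_mul S
  · rw [mem_filter]
    refine ⟨mem_univ _, fun h0 => hq ?_⟩
    rw [h0, smul_zero, norm_zero]

/-- **ENTRY of the family defect, count × sup**: for families `F, F′`, a symbol `p` with `‖p‖ ≤ P`, the pair-difference sup
`‖F′_ω(k)F′_{ω′}(k) − F_ω(k)F_{ω′}(k)‖ ≤ δ₂` and support counts `#{F_ω ≠ 0} ≤ Ns`, `#{F′_ω ≠ 0} ≤ Ns′` (uniform in `ω`):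
`‖(S(F′)ᵀN_pS(F′) − S(F)ᵀN_pS(F)) Y Y′‖ ≤ 2·(‖(βL²)⁻¹‖²·((Ns + Ns′)·(δ₂·P)))`. [cite: BenfattoGiulianiMastropietro2006, §2.7 (2.66)–(2.67); §3 (3.3)] -/
theorem norm_pullback_normalCovariance_familySub_le_of_count {β : ℝ} (hβ : β ≠ 0) (F' F : Fin N → FreqMomentum L M → ℂ)
    (p : FreqMomentum L M × Fin 2 → ℂ) {P : ℝ} (hP0 : 0 ≤ P) (hp : ∀ ks, ‖p ks‖ ≤ P) {δ₂ : ℝ} (hδ0 : 0 ≤ δ₂)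
    (hδ : ∀ (ω ω' : Fin N) (k : FreqMomentum L M), ‖F' ω k * F' ω' k - F ω k * F ω' k‖ ≤ δ₂) {Ns Ns' : ℝ}
    (hN : ∀ ω : Fin N, (((univ : Finset (FreqMomentum L M)).filter fun k => F ω k ≠ 0).card : ℝ) ≤ Ns)
    (hN' : ∀ ω : Fin N, (((univ : Finset (FreqMomentum L M)).filter fun k => F' ω k ≠ 0).card : ℝ) ≤ Ns')
    (Y Y' : SpaceTimeIdx L M × SectorLeg N) :
    ‖((sectorSubMatrix L M β F').transpose * normalCovariance L M p * sectorSubMatrix L M β F' -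
        (sectorSubMatrix L M β F).transpose * normalCovariance L M p * sectorSubMatrix L M β F) Y Y'‖ ≤
      2 * (‖((1 / (β * (L : ℝ) ^ 2) : ℝ) : ℂ)‖ ^ 2 * ((Ns + Ns') * (δ₂ * P))) := by
  classical
  -- the symbol of the defect at the spin of `Y`
  set G : FreqMomentum L M → ℂ := fun k =>
    (((1 / (β * (L : ℝ) ^ 2) : ℝ) : ℂ) ^ 2 * ((F' Y.2.1.1 k * F' Y'.2.1.1 k - F Y.2.1.1 k * F Y'.2.1.1 k) * p (k, Y.2.1.2))) with hG
  have hGsup : ∀ k, ‖G k‖ ≤ ‖((1 / (β * (L : ℝ) ^ 2) : ℝ) : ℂ)‖ ^ 2 * (δ₂ * P) := fun k => by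
    rw [hG]; dsimp only
    rw [norm_mul, norm_pow, norm_mul]
    exact mul_le_mul_of_nonneg_left (mul_le_mul (hδ _ _ k) (hp _) (norm_nonneg _) hδ0) (by positivity)
  -- its support is inside the union of the two families' supports at `ω_Y`
  have hGsupp : ∀ k, G k ≠ 0 → F Y.2.1.1 k ≠ 0 ∨ F' Y.2.1.1 k ≠ 0 := by
    intro k hk
    rcases ne_or_eq (F Y.2.1.1 k) 0 with h1 | h1
    · exact Or.inl h1
    rcases ne_or_eq (F' Y.2.1.1 k) 0 with h2 | h2
    · exact Or.inr h2
    exfalso; apply hk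
    rw [hG]; dsimp only
    rw [h1, h2, zero_mul, zero_mul, sub_self, zero_mul, mul_zero]
  have hcount : ((((univ : Finset (FreqMomentum L M)).filter fun k => G k ≠ 0).card : ℕ) : ℝ) ≤ Ns + Ns' := by
    have hsub : ((univ : Finset (FreqMomentum L M)).filter fun k => G k ≠ 0) ⊆
        ((univ : Finset (FreqMomentum L M)).filter fun k => F Y.2.1.1 k ≠ 0) ∪
          ((univ : Finset (FreqMomentum L M)).filter fun k => F' Y.2.1.1 k ≠ 0) := by
      intro k hk
      rw [mem_filter] at hk
      rw [mem_union, mem_filter, mem_filter]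
      rcases hGsupp k hk.2 with h | h
      · exact Or.inl ⟨mem_univ _, h⟩
      · exact Or.inr ⟨mem_univ _, h⟩
    calc ((((univ : Finset (FreqMomentum L M)).filter fun k => G k ≠ 0).card : ℕ) : ℝ)
        ≤ ((((univ : Finset (FreqMomentum L M)).filter fun k => F Y.2.1.1 k ≠ 0) ∪
            ((univ : Finset (FreqMomentum L M)).filter fun k => F' Y.2.1.1 k ≠ 0)).card : ℝ) := by exact_mod_cast card_le_card hsub
      _ ≤ ((((univ : Finset (FreqMomentum L M)).filter fun k => F Y.2.1.1 k ≠ 0).card : ℕ) : ℝ) +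
            ((((univ : Finset (FreqMomentum L M)).filter fun k => F' Y.2.1.1 k ≠ 0).card : ℕ) : ℝ) := by exact_mod_cast card_union_le _ _
      _ ≤ Ns + Ns' := add_le_add (hN _) (hN' _)
  -- each of the two character sums is at most count × sup
  have hchar : ∀ χ : TorusSite 1 (2 * M) × TorusSite 2 L → ℂ, (∀ q, ‖χ q‖ ≤ 1) →
      ‖∑ q : TorusSite 1 (2 * M) × TorusSite 2 L, χ q • G (⟨(q.1 0).val, ZMod.val_lt (q.1 0)⟩, q.2)‖ ≤
        ‖((1 / (β * (L : ℝ) ^ 2) : ℝ) : ℂ)‖ ^ 2 * ((Ns + Ns') * (δ₂ * P)) := by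
    intro χ hχ
    have h := norm_charSum_le_card_mul_sup χ hχ (fun q => G (⟨(q.1 0).val, ZMod.val_lt (q.1 0)⟩, q.2)) (fun q => hGsup _)
    refine h.trans ?_
    have hc := card_filter_prodTorus_le_card_filter (L := L) (M := M) (fun k => G k ≠ 0)
    calc ((((univ : Finset (TorusSite 1 (2 * M) × TorusSite 2 L)).filter fun q =>
            G (⟨(q.1 0).val, ZMod.val_lt (q.1 0)⟩, q.2) ≠ 0).card : ℕ) : ℝ) * (‖((1 / (β * (L : ℝ) ^ 2) : ℝ) : ℂ)‖ ^ 2 * (δ₂ * P))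
        ≤ (Ns + Ns') * (‖((1 / (β * (L : ℝ) ^ 2) : ℝ) : ℂ)‖ ^ 2 * (δ₂ * P)) :=
          mul_le_mul_of_nonneg_right ((Nat.cast_le.2 hc).trans hcount) (by positivity)
      _ = _ := by ring
  have hχ1 : ∀ (a b : SpaceTimeIdx L M) (q : TorusSite 1 (2 * M) × TorusSite 2 L),
      ‖torusChar q.1 (fun _ : Fin 1 => ((a.1 : ℕ) : ZMod (2 * M)) - ((b.1 : ℕ) : ZMod (2 * M))) * torusChar q.2 (a.2 - b.2)‖ ≤ 1 :=
    fun a b q => by rw [norm_mul, norm_torusChar, norm_torusChar, mul_one]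
  refine (norm_pullback_normalCovariance_familySub_le hβ F' F p Y Y').trans ?_
  have h1 := hchar _ (hχ1 Y.1 Y'.1)
  have h2 := hchar _ (hχ1 Y'.1 Y.1)
  simp only [hG] at h1 h2
  linarith [h1, h2]

end Entry


/-! ## §3 The model entry: fat families at two frames, the coarse slice; count × sup from p3's fat count and k3c3-p2's increment-pair sup -/

section Model

open Classical

variable {a b : ℝ} (B : BandBounds a b) {A μ e₀ z β : ℝ} (hADt : 2 * A < B.Dtmin)
  (he : 0 < e₀) (hz : 0 < z) (hz1 : z ≤ 1) (hgap : e₀ + A + z ^ 2 < -μ) (h3 : e₀ + A - μ ≤ 3)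
  (hlo : a ≤ μ - A - e₀) (hhi : μ + A + e₀ ≤ b) (hβ : 0 < β) (hρA : 4 * A < 2 * B.rhomin) (m : ℕ)
  {d : ℝ} (hd : 0 ≤ d) (hd1 : ∀ u, |deriv (bgmCutoffSq e₀) u| ≤ d) (hd2 : ∀ u, |iteratedDeriv 2 (bgmCutoffSq e₀) u| ≤ d)
  (hd3 : ∀ u, |iteratedDeriv 3 (bgmCutoffSq e₀) u| ≤ d) {Λ Λ' : ℝ} (hΛ : 0 < Λ) (hΛΛ' : Λ ≤ Λ')

include B hADt he hz hz1 hgap h3 hlo hhi hβ hρA hd hd1 hd2 hd3 hΛ hΛΛ'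

/-- **Entry of the FAMILY defect for the fat families of two frames `K`, `K_o` against the slice of `K`**, count × sup: with the band increment
`|e_K − e_{K_o}| ≤ P₀`, every entry is at most `2·‖(βL²)⁻¹‖²·((N_fat(K) + N_fat(K_o))·(2·[d e₀²/Λ_m²·P₀(2(Λ_m+P₀)+P₀)]·(4βL²/Λ)))`
(`norm_pullback_normalCovariance_familySub_le_of_count` with p3's `card_support_bgmFat_le` at both frames, k3c3-p2's `bgmFatIncrPair_data` sup (twice) and
`norm_sliceSymbolFnXi_le`). [cite: BenfattoGiulianiMastropietro2006, §2.7 (2.66)–(2.67); §3 (3.3)] -/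
theorem norm_sliceCT_familySub_bgmFat_apply_le {L M : ℕ} [NeZero L] [NeZero M] {K Ko : TrigPolyC4v}
    (hA : ∀ p : Momentum, ∀ j ≤ 2, ‖iteratedFDeriv ℝ j (frameShift K) p‖ ≤ A) (hA' : ∀ p : Momentum, ∀ j ≤ 2, ‖iteratedFDeriv ℝ j (frameShift Ko) p‖ ≤ A)
    {K₂ : ℝ} (hK₂ : ∀ p, ‖iteratedFDeriv ℝ 2 (frameLevel μ K) p‖ ≤ K₂) (hK₂' : ∀ p, ‖iteratedFDeriv ℝ 2 (frameLevel μ Ko) p‖ ≤ K₂)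
    {P₀ : ℝ} (hv₀ : ∀ p : Momentum, |frameLevel μ Ko p - frameLevel μ K p| ≤ P₀) (Y Y' : SpaceTimeIdx L M × SectorLeg (sectorCount (m + 1))) :
    ‖((sectorSubMatrix L M β (bgmFatMultiplier L M e₀ β (nambuXiCT L μ Ko) (m + 1))).transpose * hubbardCovSliceCT L M β μ 0 K Λ Λ' *
          sectorSubMatrix L M β (bgmFatMultiplier L M e₀ β (nambuXiCT L μ Ko) (m + 1)) -
        (sectorSubMatrix L M β (bgmFatMultiplier L M e₀ β (nambuXiCT L μ K) (m + 1))).transpose * hubbardCovSliceCT L M β μ 0 K Λ Λ' *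
          sectorSubMatrix L M β (bgmFatMultiplier L M e₀ β (nambuXiCT L μ K) (m + 1))) Y Y'‖ ≤
      2 * (‖((1 / (β * (L : ℝ) ^ 2) : ℝ) : ℂ)‖ ^ 2 * (((klScale e₀ m * β / π + 1) *
        ((Real.sqrt 2 * L * ((klScale e₀ m + (4 + 4 * A) *
            ((klScale e₀ m + B.smax * B.Dtmin * (3 * sectorWidth (m + 1) / 4)) / (B.Dtmin - 2 * A) +
              π * Real.sqrt 2 * (1 + (4 + 2 * A) / (B.Dtmin - 2 * A)) * sectorWidth (m + 1)) ^ 2) / (2 * B.rhomin - 4 * A)) / π + 2) *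
          (Real.sqrt 2 * L * (2 * ((klScale e₀ m + B.smax * B.Dtmin * (3 * sectorWidth (m + 1) / 4)) / (B.Dtmin - 2 * A) +
              π * Real.sqrt 2 * (1 + (4 + 2 * A) / (B.Dtmin - 2 * A)) * sectorWidth (m + 1))) / π + 2)) +
        (klScale e₀ m * β / π + 1) *
        ((Real.sqrt 2 * L * ((klScale e₀ m + (4 + 4 * A) *
            ((klScale e₀ m + B.smax * B.Dtmin * (3 * sectorWidth (m + 1) / 4)) / (B.Dtmin - 2 * A) +
              π * Real.sqrt 2 * (1 + (4 + 2 * A) / (B.Dtmin - 2 * A)) * sectorWidth (m + 1)) ^ 2) / (2 * B.rhomin - 4 * A)) / π + 2) *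
          (Real.sqrt 2 * L * (2 * ((klScale e₀ m + B.smax * B.Dtmin * (3 * sectorWidth (m + 1) / 4)) / (B.Dtmin - 2 * A) +
              π * Real.sqrt 2 * (1 + (4 + 2 * A) / (B.Dtmin - 2 * A)) * sectorWidth (m + 1))) / π + 2))) * (2 * (d * e₀ ^ 2 / klScale e₀ m ^ 2 * (P₀ * (2 * (klScale e₀ m + P₀) + P₀))) * (4 * (β * (L : ℝ) ^ 2) / Λ)))) := by
  have hP₀ : 0 ≤ P₀ := (abs_nonneg _).trans (hv₀ 0)
  have hΛm : 0 < klScale e₀ m := by rw [klScale]; positivity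
  have hc : 0 ≤ β * (L : ℝ) ^ 2 := by positivity
  have hsup0 : 0 ≤ (d * e₀ ^ 2 / klScale e₀ m ^ 2 * (P₀ * (2 * (klScale e₀ m + P₀) + P₀))) := by positivity
  -- the increment pieces in k3c3-p2's currency (both orientations)
  have hν₁ : ∀ p : Fin 2 → ℝ, (fun p : Fin 2 → ℝ => frameLevel μ K (WithLp.toLp 2 p) - frameLevel μ Ko (WithLp.toLp 2 p)) p =
      frameLevel μ K (WithLp.toLp 2 p) - frameLevel μ Ko (WithLp.toLp 2 p) := fun _ => rfl
  have hν₂ : ∀ p : Fin 2 → ℝ, (fun p : Fin 2 → ℝ => frameLevel μ Ko (WithLp.toLp 2 p) - frameLevel μ K (WithLp.toLp 2 p)) p =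
      frameLevel μ Ko (WithLp.toLp 2 p) - frameLevel μ K (WithLp.toLp 2 p) := fun _ => rfl
  have hN₁ : ∀ p : Fin 2 → ℝ, |(fun p : Fin 2 → ℝ => frameLevel μ K (WithLp.toLp 2 p) - frameLevel μ Ko (WithLp.toLp 2 p)) p| ≤ P₀ :=
    fun p => by rw [abs_sub_comm]; exact hv₀ _
  have hN₂ : ∀ p : Fin 2 → ℝ, |(fun p : Fin 2 → ℝ => frameLevel μ Ko (WithLp.toLp 2 p) - frameLevel μ K (WithLp.toLp 2 p)) p| ≤ P₀ :=
    fun p => hv₀ _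
  have hL : (0 : ℝ) < L := Nat.cast_pos.2 (Nat.pos_of_ne_zero (NeZero.ne L))
  have htan : ∀ Kx : TrigPolyC4v, ∀ ω : Fin (sectorCount (m + 1)),
      |fderiv ℝ (fun p : Fin 2 → ℝ => frameLevel μ Kx (WithLp.toLp 2 p)) (klFermiPoint μ Kx (sectorCenter (m + 1) (ω : ℕ)))
        (fun j => 2 * π / L * ((0 : Fin 2 → ℤ) j : ℝ))| ≤ 0 := fun Kx ω => by
    have h0 : (fun j : Fin 2 => 2 * π / (L : ℝ) * ((0 : Fin 2 → ℤ) j : ℝ)) = 0 := by funext j; simp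
    rw [h0, map_zero, abs_zero]
  rw [hubbardCovSliceCT_eq_normalCovariance_sliceSymbolFnXi hβ.ne' μ K Λ Λ']
  refine norm_pullback_normalCovariance_familySub_le_of_count hβ.ne' _ _ _ (by positivity)
    (fun ks => norm_sliceSymbolFnXi_le hΛ hΛΛ' hc (nambuXiCT L μ K ks.1.2)) (by positivity) (fun ω ω' k => ?_)
    (fun ω => card_support_bgmFat_le (L := L) (M := M) B hA hADt he hz hz1 hgap h3 hlo hhi hβ hρA m hd hd1 hd2 ω)
    (fun ω => card_support_bgmFat_le (L := L) (M := M) B hA' hADt he hz hz1 hgap h3 hlo hhi hβ hρA m hd hd1 hd2 ω) Y Y'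
  -- the pair difference at `k` = increment pair (K → K_o) at (ω, ω′) plus increment pair (K_o → K)ᵀ at (ω′, ω)
  obtain ⟨q, hq⟩ : ∃ q : TorusSite 1 (2 * M) × TorusSite 2 L, (⟨(q.1 0).val, ZMod.val_lt (q.1 0)⟩, q.2) = k :=
    ⟨(fun _ => ((k.1 : ℕ) : ZMod (2 * M)), k.2), by
      refine Prod.ext (Fin.ext ?_) rfl
      simp only [ZMod.val_natCast]
      exact Nat.mod_eq_of_lt k.1.isLt⟩
  have h1 := (bgmFatIncrPair_data B Ko hA hADt he hz hz1 hgap h3 hlo hhi hβ hρA m hd hd1 hd2 hd3 hK₂ hν₁ hN₁ rfl ω ω' 0 (htan K ω) _ rfl).1 q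
  have h2 := (bgmFatIncrPair_data B K hA' hADt he hz hz1 hgap h3 hlo hhi hβ hρA m hd hd1 hd2 hd3 hK₂' hν₂ hN₂ rfl ω' ω 0 (htan Ko ω') _ rfl).1 q
  rw [hq] at h1 h2
  have e : bgmFatMultiplier L M e₀ β (nambuXiCT L μ Ko) (m + 1) ω k * bgmFatMultiplier L M e₀ β (nambuXiCT L μ Ko) (m + 1) ω' k -
      bgmFatMultiplier L M e₀ β (nambuXiCT L μ K) (m + 1) ω k * bgmFatMultiplier L M e₀ β (nambuXiCT L μ K) (m + 1) ω' k =
      (bgmFatMultiplier L M e₀ β (nambuXiCT L μ Ko) (m + 1) ω k * bgmFatMultiplier L M e₀ β (nambuXiCT L μ K) (m + 1) ω' k -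
        bgmFatMultiplier L M e₀ β (nambuXiCT L μ K) (m + 1) ω k * bgmFatMultiplier L M e₀ β (nambuXiCT L μ K) (m + 1) ω' k) -
      (bgmFatMultiplier L M e₀ β (nambuXiCT L μ K) (m + 1) ω' k * bgmFatMultiplier L M e₀ β (nambuXiCT L μ Ko) (m + 1) ω k -
        bgmFatMultiplier L M e₀ β (nambuXiCT L μ Ko) (m + 1) ω' k * bgmFatMultiplier L M e₀ β (nambuXiCT L μ Ko) (m + 1) ω k) := by ring
  rw [e]
  refine (norm_sub_le _ _).trans ?_
  linarith [h1, h2]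


/-- **THE ENTRY SUP OF THE FAMILY DEFECT IS `O(ε)`, UNIFORMLY IN `(L, M, K, K_o)`** — the `sE` of the response bracket for the family-defect half of
`E_j`: for the fixed one-volume data there is `C ≥ 0` with, for ALL `L, M ≥ 1`, all admissible frames `K, K_o` (`C²` size `A`, `‖D²e‖ ≤ K₂`), every
`ε ∈ [0,1]` above `coeffNorm j (K_o ⊖ K)` (`j ≤ 3`): `‖D Y Y′‖ ≤ C·ε` — no grid density. [cite: BenfattoGiulianiMastropietro2006, §2.7 (2.66)–(2.67); §3 (3.3)] -/
theorem exists_familyDefect_entry_rate {K₂ : ℝ} :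
    ∃ C : ℝ, 0 ≤ C ∧ ∀ (L M : ℕ) [NeZero L] [NeZero M] (K Ko : TrigPolyC4v),
      (∀ p : Momentum, ∀ j ≤ 2, ‖iteratedFDeriv ℝ j (frameShift K) p‖ ≤ A) → (∀ p : Momentum, ∀ j ≤ 2, ‖iteratedFDeriv ℝ j (frameShift Ko) p‖ ≤ A) →
      (∀ p, ‖iteratedFDeriv ℝ 2 (frameLevel μ K) p‖ ≤ K₂) → (∀ p, ‖iteratedFDeriv ℝ 2 (frameLevel μ Ko) p‖ ≤ K₂) →
      ∀ ε : ℝ, 0 ≤ ε → ε ≤ 1 → (∀ j ≤ 3, (fsub Ko K).coeffNorm j ≤ ε) →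
        ∀ Y Y' : SpaceTimeIdx L M × SectorLeg (sectorCount (m + 1)), ‖((sectorSubMatrix L M β (bgmFatMultiplier L M e₀ β (nambuXiCT L μ Ko) (m + 1))).transpose * hubbardCovSliceCT L M β μ 0 K Λ Λ' *
          sectorSubMatrix L M β (bgmFatMultiplier L M e₀ β (nambuXiCT L μ Ko) (m + 1)) -
        (sectorSubMatrix L M β (bgmFatMultiplier L M e₀ β (nambuXiCT L μ K) (m + 1))).transpose * hubbardCovSliceCT L M β μ 0 K Λ Λ' *
          sectorSubMatrix L M β (bgmFatMultiplier L M e₀ β (nambuXiCT L μ K) (m + 1))) Y Y'‖ ≤ C * ε := by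
  have hΛm : 0 < klScale e₀ m := by rw [klScale]; positivity
  refine ⟨|((klScale e₀ m * β / π + 1) *
        ((Real.sqrt 2 * ((klScale e₀ m + (4 + 4 * A) * ((klScale e₀ m + B.smax * B.Dtmin * (3 * sectorWidth (m + 1) / 4)) / (B.Dtmin - 2 * A) +
              π * Real.sqrt 2 * (1 + (4 + 2 * A) / (B.Dtmin - 2 * A)) * sectorWidth (m + 1)) ^ 2) / (2 * B.rhomin - 4 * A)) / π + 2) *
          (Real.sqrt 2 * (2 * ((klScale e₀ m + B.smax * B.Dtmin * (3 * sectorWidth (m + 1) / 4)) / (B.Dtmin - 2 * A) +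
              π * Real.sqrt 2 * (1 + (4 + 2 * A) / (B.Dtmin - 2 * A)) * sectorWidth (m + 1))) / π + 2)))| * (32 * (d * e₀ ^ 2 / klScale e₀ m ^ 2 * (2 * klScale e₀ m + 3)) / (β * Λ)), by positivity, ?_⟩
  intro L M _ _ K Ko hA hA' hK₂ hK₂' ε hε0 hε1 hε Y Y'
  have hL : (0 : ℝ) < L := Nat.cast_pos.2 (Nat.pos_of_ne_zero (NeZero.ne L))
  have hL1 : (1 : ℝ) ≤ L := by exact_mod_cast Nat.pos_of_ne_zero (NeZero.ne L)
  have hA0 : 0 ≤ A := le_trans (norm_nonneg _) (hA 0 0 (by norm_num))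
  have hDt : 0 < B.Dtmin - 2 * A := by linarith
  have hρm : 0 < 2 * B.rhomin - 4 * A := by linarith
  have hρ0 : 0 ≤ ((klScale e₀ m + B.smax * B.Dtmin * (3 * sectorWidth (m + 1) / 4)) / (B.Dtmin - 2 * A) +
              π * Real.sqrt 2 * (1 + (4 + 2 * A) / (B.Dtmin - 2 * A)) * sectorWidth (m + 1)) := by
    have := B.smax_pos; have := B.Dtmin_pos; have := sectorWidth_pos (m + 1); positivity
  obtain ⟨hv₀, -, -, -⟩ := TwoPointAssembly.incrementData_of_coeffNorm' μ K Ko (hε 0 (by norm_num)) (hε 1 (by norm_num)) (hε 2 (by norm_num))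
    (hε 3 (by norm_num))
  refine (norm_sliceCT_familySub_bgmFat_apply_le B hADt he hz hz1 hgap h3 hlo hhi hβ hρA m hd hd1 hd2 hd3 hΛ hΛΛ' hA hA' hK₂ hK₂' hv₀ Y Y').trans ?_
  -- `N_fat ≤ L²·N₁`, `sup ≤ (d e₀²/Λ_m²)(2Λ_m+3)·ε`, and the cancellation of `βL²`
  have hf : ∀ X : ℝ, 0 ≤ X → Real.sqrt 2 * L * X / π + 2 ≤ L * (Real.sqrt 2 * X / π + 2) := by
    intro X hX
    have h : (L : ℝ) * (Real.sqrt 2 * X / π + 2) - (Real.sqrt 2 * L * X / π + 2) = 2 * (L - 1) := by ring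
    linarith
  have hX₁ : 0 ≤ (klScale e₀ m + (4 + 4 * A) * ((klScale e₀ m + B.smax * B.Dtmin * (3 * sectorWidth (m + 1) / 4)) / (B.Dtmin - 2 * A) +
              π * Real.sqrt 2 * (1 + (4 + 2 * A) / (B.Dtmin - 2 * A)) * sectorWidth (m + 1)) ^ 2) / (2 * B.rhomin - 4 * A) := by positivity
  have h1 := hf _ hX₁
  have h2 := hf _ (by positivity : (0:ℝ) ≤ 2 * ((klScale e₀ m + B.smax * B.Dtmin * (3 * sectorWidth (m + 1) / 4)) / (B.Dtmin - 2 * A) +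
              π * Real.sqrt 2 * (1 + (4 + 2 * A) / (B.Dtmin - 2 * A)) * sectorWidth (m + 1)))
  have hN : (klScale e₀ m * β / π + 1) *
        ((Real.sqrt 2 * L * ((klScale e₀ m + (4 + 4 * A) *
            ((klScale e₀ m + B.smax * B.Dtmin * (3 * sectorWidth (m + 1) / 4)) / (B.Dtmin - 2 * A) +
              π * Real.sqrt 2 * (1 + (4 + 2 * A) / (B.Dtmin - 2 * A)) * sectorWidth (m + 1)) ^ 2) / (2 * B.rhomin - 4 * A)) / π + 2) *
          (Real.sqrt 2 * L * (2 * ((klScale e₀ m + B.smax * B.Dtmin * (3 * sectorWidth (m + 1) / 4)) / (B.Dtmin - 2 * A) +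
              π * Real.sqrt 2 * (1 + (4 + 2 * A) / (B.Dtmin - 2 * A)) * sectorWidth (m + 1))) / π + 2)) ≤ (L : ℝ) ^ 2 * |((klScale e₀ m * β / π + 1) *
        ((Real.sqrt 2 * ((klScale e₀ m + (4 + 4 * A) * ((klScale e₀ m + B.smax * B.Dtmin * (3 * sectorWidth (m + 1) / 4)) / (B.Dtmin - 2 * A) +
              π * Real.sqrt 2 * (1 + (4 + 2 * A) / (B.Dtmin - 2 * A)) * sectorWidth (m + 1)) ^ 2) / (2 * B.rhomin - 4 * A)) / π + 2) *
          (Real.sqrt 2 * (2 * ((klScale e₀ m + B.smax * B.Dtmin * (3 * sectorWidth (m + 1) / 4)) / (B.Dtmin - 2 * A) +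
              π * Real.sqrt 2 * (1 + (4 + 2 * A) / (B.Dtmin - 2 * A)) * sectorWidth (m + 1))) / π + 2)))| := by
    calc _ ≤ (klScale e₀ m * β / π + 1) * ((L * (Real.sqrt 2 * ((klScale e₀ m + (4 + 4 * A) * ((klScale e₀ m + B.smax * B.Dtmin * (3 * sectorWidth (m + 1) / 4)) / (B.Dtmin - 2 * A) +
              π * Real.sqrt 2 * (1 + (4 + 2 * A) / (B.Dtmin - 2 * A)) * sectorWidth (m + 1)) ^ 2) / (2 * B.rhomin - 4 * A)) / π + 2)) *
          (L * (Real.sqrt 2 * (2 * ((klScale e₀ m + B.smax * B.Dtmin * (3 * sectorWidth (m + 1) / 4)) / (B.Dtmin - 2 * A) +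
              π * Real.sqrt 2 * (1 + (4 + 2 * A) / (B.Dtmin - 2 * A)) * sectorWidth (m + 1))) / π + 2))) := by gcongr
      _ = (L : ℝ) ^ 2 * ((klScale e₀ m * β / π + 1) *
        ((Real.sqrt 2 * ((klScale e₀ m + (4 + 4 * A) * ((klScale e₀ m + B.smax * B.Dtmin * (3 * sectorWidth (m + 1) / 4)) / (B.Dtmin - 2 * A) +
              π * Real.sqrt 2 * (1 + (4 + 2 * A) / (B.Dtmin - 2 * A)) * sectorWidth (m + 1)) ^ 2) / (2 * B.rhomin - 4 * A)) / π + 2) *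
          (Real.sqrt 2 * (2 * ((klScale e₀ m + B.smax * B.Dtmin * (3 * sectorWidth (m + 1) / 4)) / (B.Dtmin - 2 * A) +
              π * Real.sqrt 2 * (1 + (4 + 2 * A) / (B.Dtmin - 2 * A)) * sectorWidth (m + 1))) / π + 2))) := by ring
      _ ≤ _ := mul_le_mul_of_nonneg_left (le_abs_self _) (by positivity)
  have hsup : (d * e₀ ^ 2 / klScale e₀ m ^ 2 * (ε * (2 * (klScale e₀ m + ε) + ε))) ≤ d * e₀ ^ 2 / klScale e₀ m ^ 2 * (2 * klScale e₀ m + 3) * ε := by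
    have h : ε * (2 * (klScale e₀ m + ε) + ε) ≤ (2 * klScale e₀ m + 3) * ε := by nlinarith
    calc (d * e₀ ^ 2 / klScale e₀ m ^ 2 * (ε * (2 * (klScale e₀ m + ε) + ε))) ≤ d * e₀ ^ 2 / klScale e₀ m ^ 2 * ((2 * klScale e₀ m + 3) * ε) := mul_le_mul_of_nonneg_left h (by positivity)
      _ = _ := by ring
  have hnc : ‖((1 / (β * (L : ℝ) ^ 2) : ℝ) : ℂ)‖ ^ 2 = (1 / (β * (L : ℝ) ^ 2)) ^ 2 := by
    rw [Complex.norm_real, Real.norm_eq_abs, abs_of_nonneg (by positivity)]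
  rw [hnc]
  set Nf := (klScale e₀ m * β / π + 1) *
        ((Real.sqrt 2 * L * ((klScale e₀ m + (4 + 4 * A) *
            ((klScale e₀ m + B.smax * B.Dtmin * (3 * sectorWidth (m + 1) / 4)) / (B.Dtmin - 2 * A) +
              π * Real.sqrt 2 * (1 + (4 + 2 * A) / (B.Dtmin - 2 * A)) * sectorWidth (m + 1)) ^ 2) / (2 * B.rhomin - 4 * A)) / π + 2) *
          (Real.sqrt 2 * L * (2 * ((klScale e₀ m + B.smax * B.Dtmin * (3 * sectorWidth (m + 1) / 4)) / (B.Dtmin - 2 * A) +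
              π * Real.sqrt 2 * (1 + (4 + 2 * A) / (B.Dtmin - 2 * A)) * sectorWidth (m + 1))) / π + 2)) with hNf
  set N₁a := |((klScale e₀ m * β / π + 1) *
        ((Real.sqrt 2 * ((klScale e₀ m + (4 + 4 * A) * ((klScale e₀ m + B.smax * B.Dtmin * (3 * sectorWidth (m + 1) / 4)) / (B.Dtmin - 2 * A) +
              π * Real.sqrt 2 * (1 + (4 + 2 * A) / (B.Dtmin - 2 * A)) * sectorWidth (m + 1)) ^ 2) / (2 * B.rhomin - 4 * A)) / π + 2) *
          (Real.sqrt 2 * (2 * ((klScale e₀ m + B.smax * B.Dtmin * (3 * sectorWidth (m + 1) / 4)) / (B.Dtmin - 2 * A) +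
              π * Real.sqrt 2 * (1 + (4 + 2 * A) / (B.Dtmin - 2 * A)) * sectorWidth (m + 1))) / π + 2)))| with hN₁a
  set sD := (d * e₀ ^ 2 / klScale e₀ m ^ 2 * (ε * (2 * (klScale e₀ m + ε) + ε))) with hsD
  have hNf0 : 0 ≤ Nf := by rw [hNf]; positivity
  have hsD0 : 0 ≤ sD := by rw [hsD]; positivity
  have hN₁a0 : 0 ≤ N₁a := by rw [hN₁a]; exact abs_nonneg _
  clear_value Nf N₁a sD
  calc 2 * ((1 / (β * (L : ℝ) ^ 2)) ^ 2 * ((Nf + Nf) * (2 * sD * (4 * (β * (L : ℝ) ^ 2) / Λ))))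
      ≤ 2 * ((1 / (β * (L : ℝ) ^ 2)) ^ 2 * (((L : ℝ) ^ 2 * N₁a + (L : ℝ) ^ 2 * N₁a) *
          (2 * (d * e₀ ^ 2 / klScale e₀ m ^ 2 * (2 * klScale e₀ m + 3) * ε) * (4 * (β * (L : ℝ) ^ 2) / Λ)))) := by gcongr
    _ = N₁a * (32 * (d * e₀ ^ 2 / klScale e₀ m ^ 2 * (2 * klScale e₀ m + 3)) / (β * Λ)) * ε := by field_simp; ring

end Model

end Summit.HubbardSuperconductivity.HubbardSuperconductivity.Theorems.TorusFourierL2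

end
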